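import Summits.MatrixMultiplication.OmegaCensus.ThreeSetZ5Z5CoverKitE3Split
import Summits.MatrixMultiplication.OmegaCensus.DominoZ5Z5Data19S0
import HarnessLib

/-!
# Three-margin cover computations for `(1,9,12)@325`, hole class `σ = 0`, flagged row `11`

ω-census `pub-omega`, family (b3), seat pub-omega-group gen 37 (staged), landed by gen 38.  Framing: lottery ticket; floor = certified
bounds/negative ranges.  VALUE: kernel computations of the `ℤ₅²` stage of the census cell `(1,9,12)@325` of `ℤ₅ × ℤ₆₅`
(design `HOME/pub-omega-group-g37/DESIGN-1-9-12.md`); NOT progress on ω.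
Each `decide + kernel` covers ONE flagged row-sum vector and ONE group of `8` flagged column vectors over all `32` flagged diagonal vectors
(≈ 30–40 s of kernel time each on an idle farm node; one row per file keeps the gate's 600 s verification budget).
-/

namespace Summit.MatrixMultiplication.OmegaCensus

namespace Z5Z5ThreeSet

open ZpZpDomino

set_option maxRecDepth 100000 in
set_option maxHeartbeats 4000000 in
/-- Cover computation: flagged row `11`, column group `0`. [folklore] -/
theorem cov19s0_r11_c0 : coverGenE3 tree19s0 exc19s0 10 (rowWs 5 10) (diagIdx 5) [flR19s0.getD 11 []] (flCg19s0.getD 0 [])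
    flD19s0 (offs 5 10) (off 5 10 1) (off 5 10 2) = true := by decide +kernel

set_option maxRecDepth 100000 in
set_option maxHeartbeats 4000000 in
/-- Cover computation: flagged row `11`, column group `1`. [folklore] -/
theorem cov19s0_r11_c1 : coverGenE3 tree19s0 exc19s0 10 (rowWs 5 10) (diagIdx 5) [flR19s0.getD 11 []] (flCg19s0.getD 1 [])
    flD19s0 (offs 5 10) (off 5 10 1) (off 5 10 2) = true := by decide +kernel

set_option maxRecDepth 100000 in
set_option maxHeartbeats 4000000 in
/-- Cover computation: flagged row `11`, column group `2`. [folklore] -/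
theorem cov19s0_r11_c2 : coverGenE3 tree19s0 exc19s0 10 (rowWs 5 10) (diagIdx 5) [flR19s0.getD 11 []] (flCg19s0.getD 2 [])
    flD19s0 (offs 5 10) (off 5 10 1) (off 5 10 2) = true := by decide +kernel

set_option maxRecDepth 100000 in
set_option maxHeartbeats 4000000 in
/-- Cover computation: flagged row `11`, column group `3`. [folklore] -/
theorem cov19s0_r11_c3 : coverGenE3 tree19s0 exc19s0 10 (rowWs 5 10) (diagIdx 5) [flR19s0.getD 11 []] (flCg19s0.getD 3 [])
    flD19s0 (offs 5 10) (off 5 10 1) (off 5 10 2) = true := by decide +kernel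

/-- Flagged row `11`: all column groups. [folklore] -/
theorem cov19s0_r11 : coverGenE3 tree19s0 exc19s0 10 (rowWs 5 10) (diagIdx 5) [flR19s0.getD 11 []] flCg19s0.flatten flD19s0
    (offs 5 10) (off 5 10 1) (off 5 10 2) = true :=
  coverGenE3_of_chunks _ _ _ _ _ _ _ _ _ _ (by decide +kernel) _ (by
    intro C hC
    simp only [flCg19s0, List.mem_cons, List.mem_nil_iff, or_false] at hC
    rcases hC with rfl | rfl | rfl | rfl
    · exact cov19s0_r11_c0
    · exact cov19s0_r11_c1
    · exact cov19s0_r11_c2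
    · exact cov19s0_r11_c3)

end Z5Z5ThreeSet

end Summit.MatrixMultiplication.OmegaCensus
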